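import Mathlib.LinearAlgebra.Matrix.Determinant.Basic
import Mathlib.LinearAlgebra.Matrix.Block
import Mathlib.Data.Matrix.Block
import Mathlib.RingTheory.PowerSeries.Inverse
import Mathlib.Algebra.BigOperators.Fin
import Mathlib.Order.WellFounded
import Literature.Analysis.TotalPositivity.PolyaFrequency
import Mathlib.Topology.Instances.Matrix
import Mathlib.Topology.Order.MonotoneConvergence
import Mathlib.Analysis.SpecificLimits.Basic
import Literature.Analysis.TotalPositivity.PolyaFrequencyClosure
import HarnessLib

/-!
# Deflation of Pólya frequency sequences: the reciprocal series and the virtual row (proved)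

Trunk T-ANALYSIS (Literature/Analysis/TotalPositivity). Nodes A–B of the proof of the `⇒` half of
`Literature.Analysis.TotalPositivity.pf_taylor_iff_zeros_of_order_lt_one` (PolyaFrequency.lean; Karlin 1968,
Ch. 8, Thm. 5.3, entire case) WITHOUT the full Aissen–Schoenberg–Whitney–Edrei representation:
we follow the architecture of Aissen–Schoenberg–Whitney 1952 (the reciprocal `1/f(-z)` generates a
totally positive sequence, §2; zeros are divided out one at a time, §3) but run the deflation in the
weaker class of COLUMN-POSITIVE sequences (all minors with consecutive columns `≥ 0`), which makes
each step elementary. The analytic half (Taylor series of `1/F(-z)`, location of the pole on the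
positive axis, the induction) is `PolyaFrequencyZeros.lean`.

* Part A (linear algebra). `det_indMat_shuffle`: the determinant of the `0/1` "shuffle" matrix of
  an injective `f : Fin N → Fin N` increasing on `{y < p}` and on `{p ≤ y}` is `(-1)^{Σ_{y<p}(f y - y)}`
  (Laplace expansion along the first column). `det_mul_det_toBlocks₁₁`: Jacobi's identity in block
  form, `det A · det B₁₁ = det A₂₂` for `A B = 1`. `psToeplitz φ N`: the truncated Toeplitz matrix
  of a power series, multiplicative in `φ`. `recipSeq a` / `negRecipSeq a`: Taylor coefficients of
  `1/F(z)` and `1/F(-z)`, `F = Σ aₙ zⁿ`, `a₀ = 1`. MAIN: `toeplitzMinor_negRecipSeq_consecutive` —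
  for a PF sequence `a` (`a₀ = 1`), every minor of `(b_{i-j})`, `b = negRecipSeq a`, with
  consecutive columns is `≥ 0` (it equals a complementary minor of `(a_{i-j})`; the two signs, the
  shuffle sign `(-1)^{Σ(rᵢ-i)}` and the checkerboard `(-1)^{Σ(rᵢ+i)}`, cancel).
* Part B (sequences). `IsColumnPF b`; positivity, log-concavity-type inequalities, the ratio
  `b_{n+1}/bₙ ↓ ℓ = ratioLimit b`, `b_{n+s}/bₙ → ℓˢ`, two-sided geometric bounds. MAIN (the
  "virtual row"): `IsColumnPF.mulLinear_neg` — if `b` is column-positive with `bₙ > 0` and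
  `b_{n+s}/bₙ → ℓˢ`, then `(bₙ - ℓ b_{n-1})ₙ` is column-positive: a consecutive-column minor of the
  new sequence is the limit of minors of `b` with one extra far row `N → ∞`, normalised by
  `b_{N-j-p}` (right multiplication by the unit bidiagonal `1 - ℓL`).

## References

* M. Aissen, I. J. Schoenberg, A. M. Whitney, *On the generating functions of totally positive
  sequences I*, J. Analyse Math. 2 (1952) 93–103, §§2–3.
* M. Aissen, A. Edrei, I. J. Schoenberg, A. Whitney, *On the generating functions of totally
  positive sequences*, Proc. Nat. Acad. Sci. USA 37 (1951) 303–307, Thms. 2, 5.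
* S. Karlin, *Total Positivity I*, Stanford UP 1968, Ch. 8, §§1–3 and Thm. 5.3.
* S. M. Fallat, C. R. Johnson, *Totally Nonnegative Matrices*, Princeton UP 2011, §1.2 (Jacobi's
  identity, eqs. (1.2)–(1.3)), §3.3.
-/

noncomputable section

open Finset Matrix

namespace Literature.Analysis.TotalPositivity

/-! ### The shuffle determinant -/

/-- The `0/1` matrix of a self-map `f` of `Fin N`: entry `(x, y)` is `1` iff `x = f y`. [folklore] -/
def indMat (N : ℕ) (f : Fin N → Fin N) : Matrix (Fin N) (Fin N) ℝ :=
  Matrix.of fun x y => if x = f y then 1 else 0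

/-- A strictly monotone self-map of `Fin N` is the identity. [folklore] -/
theorem eq_self_of_strictMono {N : ℕ} {f : Fin N → Fin N} (hf : StrictMono f) (y : Fin N) :
    f y = y :=
  le_antisymm (hf.le_id y) (hf.id_le y)

/-- **Determinant of a shuffle matrix.** If `f : Fin N → Fin N` is injective, strictly increasing
on `{y < p}` and on `{p ≤ y}`, then `det (indMat N f) = (-1)^{Σ_{y < p} (f y - y)}` (Laplace
expansion along the first column, induction on `N`). [folklore] -/
theorem det_indMat_shuffle : ∀ (N p : ℕ) (f : Fin N → Fin N), Function.Injective f →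
    (∀ y y' : Fin N, (y' : ℕ) < p → y < y' → f y < f y') →
    (∀ y y' : Fin N, p ≤ (y : ℕ) → y < y' → f y < f y') →
    (indMat N f).det = (-1) ^ (∑ y : Fin N, if (y : ℕ) < p then ((f y : ℕ) - y) else 0) := by
  intro N
  induction N with
  | zero =>
    intro p f _ _ _
    simp [Matrix.det_isEmpty]
  | succ N ih =>
    intro p f hinj h1 h2
    rcases Nat.eq_zero_or_pos p with hp | hp
    · -- `p = 0`: `f` is strictly monotone, hence the identity
      subst hp
      have hmono : StrictMono f := fun y y' hyy' => h2 y y' (Nat.zero_le _) hyy'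
      have hf : ∀ y, f y = y := eq_self_of_strictMono hmono
      have : indMat (N + 1) f = 1 := by
        ext x y
        simp [indMat, hf, Matrix.one_apply]
      rw [this, Matrix.det_one]
      simp
    · -- `p ≥ 1`: expand along column `0`
      rw [Matrix.det_succ_column_zero]
      have hcol : ∀ x : Fin (N + 1), indMat (N + 1) f x 0 = if x = f 0 then 1 else 0 := fun x => rfl
      simp only [hcol]
      rw [Finset.sum_eq_single (f 0)]
      rotate_left
      · intro x _ hx
        simp [hx]
      · intro h; exact absurd (Finset.mem_univ _) h
      simp only [if_true, mul_one]
      -- the reduced map `f'`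
      have hne : ∀ y' : Fin N, f (Fin.succ y') ≠ f 0 := fun y' h =>
        Fin.succ_ne_zero y' (hinj h)
      choose f' hf' using fun y' : Fin N => Fin.exists_succAbove_eq (hne y')
      -- `hf' y' : (f 0).succAbove (f' y') = f y'.succ`
      have hsub : (indMat (N + 1) f).submatrix (f 0).succAbove Fin.succ = indMat N f' := by
        ext x' y'
        simp only [Matrix.submatrix_apply, indMat, Matrix.of_apply, ← hf' y',
          Fin.succAbove_right_inj]
      rw [hsub]
      -- properties of `f'`
      have hinj' : Function.Injective f' := by
        intro y₁ y₂ h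
        have : f y₁.succ = f y₂.succ := by rw [← hf' y₁, ← hf' y₂, h]
        exact Fin.succ_injective _ (hinj this)
      have hlt : ∀ y₁ y₂ : Fin N, f' y₁ < f' y₂ ↔ f y₁.succ < f y₂.succ := by
        intro y₁ y₂
        rw [← hf' y₁, ← hf' y₂, Fin.succAbove_lt_succAbove_iff]
      have h1' : ∀ y y' : Fin N, (y' : ℕ) < p - 1 → y < y' → f' y < f' y' := by
        intro y y' hy' hyy'
        rw [hlt]
        exact h1 _ _ (by simp; omega) (Fin.succ_lt_succ_iff.2 hyy')
      have h2' : ∀ y y' : Fin N, p - 1 ≤ (y : ℕ) → y < y' → f' y < f' y' := by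
        intro y y' hy hyy'
        rw [hlt]
        exact h2 _ _ (by simp; omega) (Fin.succ_lt_succ_iff.2 hyy')
      rw [ih (p - 1) f' hinj' h1' h2']
      -- the exponents
      have hval : ∀ y' : Fin N, (y' : ℕ) + 1 < p → ((f y'.succ : ℕ)) = (f' y' : ℕ) + 1 := by
        intro y' hy'
        have hgt : f 0 < f y'.succ := h1 _ _ (by simpa using hy') (Fin.succ_pos _)
        rw [← hf' y'] at hgt ⊢
        rw [Fin.lt_succAbove_iff_le_castSucc] at hgt
        rw [Fin.succAbove_of_le_castSucc _ _ hgt]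
        simp
      rw [Fin.sum_univ_succ]
      simp only [Fin.val_zero, hp, if_true, Nat.sub_zero, Fin.val_succ]
      have hsum : (∑ y' : Fin N, if (y' : ℕ) + 1 < p then ((f y'.succ : ℕ) - ((y' : ℕ) + 1)) else 0) =
          ∑ y' : Fin N, if (y' : ℕ) < p - 1 then ((f' y' : ℕ) - y') else 0 := by
        refine Finset.sum_congr rfl fun y' _ => ?_
        by_cases hy' : (y' : ℕ) + 1 < p
        · rw [if_pos hy', if_pos (by omega), hval y' hy']
          omega
        · rw [if_neg hy', if_neg (by omega)]
      rw [hsum, pow_add]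

/-! ### Block form of Jacobi's identity -/

/-- **Jacobi's complementary-minor identity, block form.** If `A * B = 1` (square blocks), then
`det A · det B₁₁ = det A₂₂`: multiply `A` by `[[B₁₁, 0], [B₂₁, 1]]` to get `[[1, A₁₂], [0, A₂₂]]`.
(Jacobi 1834; Fallat–Johnson 2011, §1.2, eq. (1.2) and its principal case (1.3)).
[cite: FallatJohnson2011, §1.2 eqs. (1.2)–(1.3)] -/
theorem det_mul_det_toBlocks₁₁ {p q : Type*} [Fintype p] [Fintype q] [DecidableEq p]
    [DecidableEq q] (A B : Matrix (p ⊕ q) (p ⊕ q) ℝ) (h : A * B = 1) :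
    A.det * B.toBlocks₁₁.det = A.toBlocks₂₂.det := by
  have hA := Matrix.fromBlocks_toBlocks A
  have hB := Matrix.fromBlocks_toBlocks B
  rw [← hA, ← hB, Matrix.fromBlocks_multiply, ← Matrix.fromBlocks_one, Matrix.fromBlocks_inj] at h
  obtain ⟨h11, -, h21, -⟩ := h
  have hprod : A * Matrix.fromBlocks B.toBlocks₁₁ 0 B.toBlocks₂₁ 1 =
      Matrix.fromBlocks 1 A.toBlocks₁₂ 0 A.toBlocks₂₂ := by
    conv_lhs => rw [← hA]
    rw [Matrix.fromBlocks_multiply, h11, h21]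
    simp
  have := congrArg Matrix.det hprod
  rw [Matrix.det_mul, Matrix.det_fromBlocks_zero₁₂, Matrix.det_fromBlocks_zero₂₁] at this
  simpa using this

/-! ### Truncated Toeplitz matrices of power series -/

open PowerSeries in
/-- The `N × N` lower-triangular Toeplitz matrix `(coeff_{i-j} φ)_{i,j < N}` of a power series.
[cite: Karlin1968, Ch. 8 §1] -/
def psToeplitz (φ : PowerSeries ℝ) (N : ℕ) : Matrix (Fin N) (Fin N) ℝ :=
  Matrix.of fun i j => if (j : ℕ) ≤ i then coeff ((i : ℕ) - j) φ else 0

open PowerSeries in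
/-- Toeplitz matrices multiply like power series. [folklore] -/
theorem psToeplitz_mul (φ ψ : PowerSeries ℝ) (N : ℕ) :
    psToeplitz (φ * ψ) N = psToeplitz φ N * psToeplitz ψ N := by
  ext i j
  simp only [psToeplitz, Matrix.mul_apply, Matrix.of_apply]
  -- rewrite the right-hand side as a sum over `ℕ`
  have hR : (∑ s : Fin N, (if (s : ℕ) ≤ i then coeff ((i : ℕ) - s) φ else 0) *
      (if (j : ℕ) ≤ s then coeff ((s : ℕ) - j) ψ else 0)) =
      ∑ s ∈ Finset.Ico (j : ℕ) ((i : ℕ) + 1), coeff ((i : ℕ) - s) φ * coeff (s - j) ψ := by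
    rw [Finset.sum_fin_eq_sum_range]
    symm
    refine Finset.sum_subset_zero_on_sdiff ?_ ?_ ?_
    · intro s hs
      simp only [Finset.mem_Ico] at hs
      simp only [Finset.mem_range]
      have := i.2
      omega
    · intro s hs
      simp only [Finset.mem_sdiff, Finset.mem_range, Finset.mem_Ico, not_and, not_lt] at hs
      rw [dif_pos hs.1]
      by_cases h1 : (s : ℕ) ≤ i
      · have h2 : ¬ ((j : ℕ) ≤ s) := fun h => by have := hs.2 h; omega
        simp [h2]
      · simp [h1]
    · intro s hs
      simp only [Finset.mem_Ico] at hs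
      have hsN : s < N := by have := i.2; omega
      rw [dif_pos hsN, if_pos (by simpa using by omega), if_pos (by simpa using hs.1)]
  rw [hR]
  split_ifs with hji
  · obtain ⟨m, hm⟩ := i
    obtain ⟨n, hn⟩ := j
    dsimp only at hji ⊢
    rw [coeff_mul, Finset.Nat.sum_antidiagonal_eq_sum_range_succ_mk, Finset.sum_Ico_eq_sum_range,
      show m + 1 - n = m - n + 1 by omega, ← Finset.sum_range_reflect]
    refine Finset.sum_congr rfl fun k hk => ?_
    simp only [Finset.mem_range] at hk
    dsimp only
    have e1 : m - n + 1 - 1 - k = m - (n + k) := by omega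
    rw [e1]
    have e2 : m - n - (m - (n + k)) = n + k - n := by omega
    rw [e2]
  · symm
    apply Finset.sum_eq_zero
    intro s hs
    simp only [Finset.mem_Ico] at hs
    omega

open PowerSeries in
/-- The Toeplitz matrix of `1` is the identity. [folklore] -/
theorem psToeplitz_one (N : ℕ) : psToeplitz (1 : PowerSeries ℝ) N = 1 := by
  ext i j
  simp only [psToeplitz, Matrix.of_apply, coeff_one, Matrix.one_apply]
  by_cases h : i = j
  · subst h; simp
  · have : (i : ℕ) ≠ j := fun h' => h (Fin.ext h')
    by_cases hle : (j : ℕ) ≤ i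
    · rw [if_pos hle, if_neg (by omega), if_neg h]
    · rw [if_neg hle, if_neg h]

open PowerSeries in
/-- The Toeplitz matrix is lower triangular with constant diagonal, so its determinant is
`(coeff 0 φ)^N`. [folklore] -/
theorem det_psToeplitz (φ : PowerSeries ℝ) (N : ℕ) :
    (psToeplitz φ N).det = (coeff 0 φ) ^ N := by
  rw [Matrix.det_of_lowerTriangular]
  · simp [psToeplitz]
  · intro i j hij
    simp only [psToeplitz, Matrix.of_apply]
    have : (i : ℕ) < j := hij
    rw [if_neg (by omega)]

/-- `seqZ a (m - n)` for natural `m, n`. [folklore] -/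
theorem seqZ_natCast_sub_natCast (a : ℕ → ℝ) (m n : ℕ) :
    seqZ a ((m : ℤ) - n) = if n ≤ m then a (m - n) else 0 := by
  split_ifs with h
  · have : ((m : ℤ) - n) = ((m - n : ℕ) : ℤ) := by push_cast [h]; ring
    rw [this, seqZ_natCast]
  · exact seqZ_of_neg a (by omega)

open PowerSeries in
/-- Entries of the Toeplitz matrix of `PowerSeries.mk a` are `seqZ a (i - j)`. [folklore] -/
theorem psToeplitz_mk_apply (a : ℕ → ℝ) (N : ℕ) (i j : Fin N) :
    psToeplitz (PowerSeries.mk a) N i j = seqZ a ((i : ℤ) - j) := by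
  rw [seqZ_natCast_sub_natCast]
  simp [psToeplitz]

/-! ### The reciprocal sequence and its consecutive-column minors -/

open PowerSeries in
/-- Taylor coefficients of `1 / (Σₙ aₙ Xⁿ)` (meaningful for `a₀ ≠ 0`). [folklore] -/
def recipSeq (a : ℕ → ℝ) (n : ℕ) : ℝ :=
  coeff n (PowerSeries.mk a)⁻¹

/-- Taylor coefficients of `1 / F(-X)` for `F = Σₙ aₙ Xⁿ`: `bₙ = (-1)ⁿ · recipSeq a n`.
[Aissen–Schoenberg–Whitney 1952, §2 (the reciprocal `1/f(-z)`)] [cite: AissenSchoenbergWhitney1952, §2] -/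
def negRecipSeq (a : ℕ → ℝ) (n : ℕ) : ℝ :=
  (-1) ^ n * recipSeq a n

open PowerSeries in
/-- The convolution identity `Σ_{k ≤ n} a_k · recipSeq a (n - k) = [n = 0]` (`a₀ ≠ 0`). [folklore] -/
theorem sum_mul_recipSeq {a : ℕ → ℝ} (h0 : a 0 ≠ 0) (n : ℕ) :
    ∑ k ∈ Finset.range (n + 1), a k * recipSeq a (n - k) = if n = 0 then 1 else 0 := by
  have h := PowerSeries.mul_inv_cancel (PowerSeries.mk a) (by simpa using h0)
  have := congrArg (coeff n) h
  rw [coeff_mul, Finset.Nat.sum_antidiagonal_eq_sum_range_succ_mk, coeff_one] at this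
  simpa [recipSeq] using this

/-- `recipSeq a 0 = 1` when `a₀ = 1`. [folklore] -/
theorem recipSeq_zero {a : ℕ → ℝ} (h0 : a 0 = 1) : recipSeq a 0 = 1 := by
  have := sum_mul_recipSeq (a := a) (by rw [h0]; exact one_ne_zero) 0
  simpa [h0] using this

/-- `negRecipSeq a 0 = 1` when `a₀ = 1`. [folklore] -/
theorem negRecipSeq_zero {a : ℕ → ℝ} (h0 : a 0 = 1) : negRecipSeq a 0 = 1 := by
  simp [negRecipSeq, recipSeq_zero h0]

/-- A strictly monotone `r : Fin p → ℕ` dominates the index. [folklore] -/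
theorem le_of_strictMono_fin {p : ℕ} {r : Fin p → ℕ} (hr : StrictMono r) (i : Fin p) :
    (i : ℕ) ≤ r i := by
  obtain ⟨k, hk⟩ := i
  induction k with
  | zero => exact Nat.zero_le _
  | succ k ih =>
    have h1 := ih (Nat.lt_of_succ_lt hk)
    have h2 : r ⟨k, Nat.lt_of_succ_lt hk⟩ < r ⟨k + 1, hk⟩ := hr (by simp)
    simp only at h1 ⊢
    omega

/-- `(-1)^(n-k) = (-1)^n (-1)^k` for `k ≤ n`. [folklore] -/
theorem neg_one_pow_sub' {n k : ℕ} (h : k ≤ n) : ((-1 : ℝ)) ^ (n - k) = (-1) ^ n * (-1) ^ k := by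
  have : ((-1 : ℝ)) ^ n = (-1) ^ (n - k) * (-1) ^ k := by rw [← pow_add, Nat.sub_add_cancel h]
  rw [this, mul_assoc, ← pow_add, ← two_mul, pow_mul]
  norm_num

/-- **Consecutive-column minors of the reciprocal, `j = 0`.** For a PF sequence `a` with `a₀ = 1`
and `b = negRecipSeq a` (Taylor coefficients of `1/F(-z)`), every minor of `(b_{i-j})` with rows
`r₀ < ⋯ < r_{p-1}` and columns `0, 1, …, p-1` equals the complementary minor of `(a_{i-j})`
(rows `p, …, N-1`, columns `{0,…,N-1} ∖ {rᵢ}`) and hence is `≥ 0` — Jacobi's identity for the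
inverse pair `T_N(a) · T_N(recipSeq a) = 1` and the shuffle sign `(-1)^{Σ(rᵢ - i)}`.
[Karlin 1968, Ch. 8, §3] [cite: AissenSchoenbergWhitney1952, §2] -/
theorem toeplitzMinor_negRecipSeq_initial {a : ℕ → ℝ} (hpf : IsPolyaFrequencySeq a)
    (h0 : a 0 = 1) {p : ℕ} (r : Fin p → ℕ) (hr : StrictMono r) :
    0 ≤ toeplitzMinor (negRecipSeq a) r (fun k => (k : ℕ)) := by
  classical
  -- ambient size `N = p + q`
  set q : ℕ := Finset.univ.sup r + 1 with hq
  have hrN : ∀ i, r i < p + q := fun i => by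
    have : r i ≤ Finset.univ.sup r := Finset.le_sup (Finset.mem_univ i)
    omega
  set R : Fin p → Fin (p + q) := fun i => ⟨r i, hrN i⟩ with hRdef
  have hR : StrictMono R := fun i j hij => by
    show r i < r j
    exact hr hij
  -- the complement enumeration
  set s : Finset (Fin (p + q)) := (Finset.univ.image R)ᶜ with hs
  have hcard : s.card = q := by
    rw [hs, Finset.card_compl, Finset.card_image_of_injective _ hR.injective]
    simp
  set rc : Fin q ↪o Fin (p + q) := s.orderEmbOfFin hcard with hrcdef
  have hrc_ne : ∀ l i, rc l ≠ R i := by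
    intro l i h
    have hmem : rc l ∈ s := s.orderEmbOfFin_mem hcard l
    rw [hs, Finset.mem_compl] at hmem
    exact hmem (Finset.mem_image.2 ⟨i, Finset.mem_univ _, h.symm⟩)
  -- the shuffle bijection
  set e : Fin p ⊕ Fin q → Fin (p + q) := Sum.elim R rc with he
  have hinj : Function.Injective e := by
    rintro (i | l) (i' | l') h
    · simp only [he, Sum.elim_inl] at h; rw [hR.injective h]
    · simp only [he, Sum.elim_inl, Sum.elim_inr] at h; exact absurd h.symm (hrc_ne l' i)
    · simp only [he, Sum.elim_inl, Sum.elim_inr] at h; exact absurd h (hrc_ne l i')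
    · simp only [he, Sum.elim_inr] at h; rw [rc.injective h]
  have hbij : Function.Bijective e :=
    (Fintype.bijective_iff_injective_and_card e).2 ⟨hinj, by simp⟩
  set eR : Fin p ⊕ Fin q ≃ Fin (p + q) := Equiv.ofBijective e hbij with heR
  set eC : Fin p ⊕ Fin q ≃ Fin (p + q) := finSumFinEquiv with heC
  -- the inverse pair of Toeplitz matrices
  set φ : PowerSeries ℝ := PowerSeries.mk a with hφ
  have hφ0 : PowerSeries.constantCoeff φ ≠ 0 := by simp [hφ, h0]
  set A := psToeplitz φ (p + q) with hA
  set B := psToeplitz φ⁻¹ (p + q) with hB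
  have hAB : A * B = 1 := by
    rw [hA, hB, ← psToeplitz_mul, PowerSeries.mul_inv_cancel _ hφ0, psToeplitz_one]
  have hdetA : A.det = 1 := by
    rw [hA, det_psToeplitz]; simp [hφ, h0]
  set A' := A.submatrix eC eR with hA'
  set B' := B.submatrix eR eC with hB'
  have hA'B' : A' * B' = 1 := by
    rw [hA', hB', Matrix.submatrix_mul_equiv, hAB, Matrix.submatrix_one_equiv]
  -- Jacobi
  have hJ := det_mul_det_toBlocks₁₁ A' B' hA'B'
  -- `det A'` is the shuffle sign
  set f : Fin (p + q) → Fin (p + q) := e ∘ eC.symm with hf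
  have hdetA' : A'.det = (indMat (p + q) f).det := by
    have h1 : A' = A.submatrix eC eC * (1 : Matrix _ _ ℝ).submatrix eC eR := by
      rw [Matrix.submatrix_mul_equiv, Matrix.mul_one]
    rw [h1, Matrix.det_mul, Matrix.det_submatrix_equiv_self, hdetA, one_mul,
      ← Matrix.det_submatrix_equiv_self eC.symm]
    congr 1
    ext x y
    simp [indMat, hf, Matrix.one_apply, heR]
  have hf_lo : ∀ i : Fin p, f (Fin.castAdd q i) = R i := by
    intro i
    rw [hf, Function.comp_apply, heC, finSumFinEquiv_symm_apply_castAdd]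
    simp [he]
  have hf_hi : ∀ k : Fin q, f (Fin.natAdd p k) = rc k := by
    intro k
    rw [hf, Function.comp_apply, heC, finSumFinEquiv_symm_apply_natAdd]
    simp [he]
  have hcast_lo : ∀ y : Fin (p + q), (y : ℕ) < p → ∃ i : Fin p, Fin.castAdd q i = y :=
    fun y hy => ⟨⟨y, hy⟩, Fin.ext rfl⟩
  have hcast_hi : ∀ y : Fin (p + q), p ≤ (y : ℕ) → ∃ k : Fin q, Fin.natAdd p k = y :=
    fun y hy => ⟨⟨(y : ℕ) - p, by have := y.2; omega⟩, Fin.ext (by simp; omega)⟩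
  have hfinj : Function.Injective f := hinj.comp eC.symm.injective
  have hf1 : ∀ y y' : Fin (p + q), (y' : ℕ) < p → y < y' → f y < f y' := by
    intro y y' hy' hyy'
    obtain ⟨i, rfl⟩ := hcast_lo y (lt_trans hyy' hy')
    obtain ⟨i', rfl⟩ := hcast_lo y' hy'
    rw [hf_lo, hf_lo]
    exact hR ((Fin.strictMono_castAdd q).lt_iff_lt.1 hyy')
  have hf2 : ∀ y y' : Fin (p + q), p ≤ (y : ℕ) → y < y' → f y < f y' := by
    intro y y' hy hyy'
    obtain ⟨k, rfl⟩ := hcast_hi y hy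
    obtain ⟨k', rfl⟩ := hcast_hi y' (le_trans hy (le_of_lt hyy'))
    rw [hf_hi, hf_hi]
    exact rc.strictMono ((Fin.strictMono_natAdd p).lt_iff_lt.1 hyy')
  have hshuffle := det_indMat_shuffle (p + q) p f hfinj hf1 hf2
  have hexp : (∑ y : Fin (p + q), if (y : ℕ) < p then ((f y : ℕ) - y) else 0) =
      ∑ i : Fin p, (r i - i) := by
    rw [Fin.sum_univ_add]
    have h2 : (∑ k : Fin q, if ((Fin.natAdd p k : Fin (p + q)) : ℕ) < p then
        ((f (Fin.natAdd p k) : ℕ) - (Fin.natAdd p k : ℕ)) else 0) = 0 :=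
      Finset.sum_eq_zero fun k _ => by simp
    rw [h2, add_zero]
    refine Finset.sum_congr rfl fun i _ => ?_
    have hi : ((Fin.castAdd q i : Fin (p + q)) : ℕ) < p := by simp
    rw [if_pos hi, hf_lo i]
    simp [hRdef]
  rw [hexp] at hshuffle
  -- identify the blocks
  set M : Matrix (Fin p) (Fin p) ℝ := Matrix.of fun i k => seqZ (recipSeq a) ((r i : ℤ) - (k : ℕ))
    with hM
  have hB11 : B'.toBlocks₁₁ = M := by
    ext i k
    have h1 : B'.toBlocks₁₁ i k = B (R i) (Fin.castAdd q k) := by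
      simp [Matrix.toBlocks₁₁, hB', heR, he, heC, finSumFinEquiv_apply_left]
    rw [h1, hM, Matrix.of_apply, seqZ_natCast_sub_natCast, hB]
    simp only [psToeplitz, Matrix.of_apply, Fin.val_castAdd, hRdef, recipSeq, hφ]
  have hA22 : A'.toBlocks₂₂.det =
      toeplitzMinor a (fun k : Fin q => p + (k : ℕ)) (fun l => (rc l : ℕ)) := by
    unfold toeplitzMinor
    congr 1
    ext k l
    have h1 : A'.toBlocks₂₂ k l = A (Fin.natAdd p k) (rc l) := by
      simp [Matrix.toBlocks₂₂, hA', heR, he, heC, finSumFinEquiv_apply_right]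
    rw [h1, Matrix.of_apply, hA, hφ, psToeplitz_mk_apply, Fin.val_natAdd, Nat.cast_add]
  have hA22_nonneg : 0 ≤ A'.toBlocks₂₂.det := by
    rw [hA22]
    refine hpf q _ _ (fun k l hkl => by simpa using hkl) (fun k l hkl => rc.strictMono hkl)
  -- `det M = (-1)^{Σ(rᵢ - i)} · det A'₂₂`
  have hdetM : M.det = (-1) ^ (∑ i : Fin p, (r i - i)) * A'.toBlocks₂₂.det := by
    rw [← hJ, hB11, hdetA', hshuffle, ← mul_assoc, ← pow_add, ← two_mul, pow_mul]
    norm_num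
  -- the target minor is `M` with row `i` scaled by `(-1)^{rᵢ}` and column `k` by `(-1)^k`
  have htarget : toeplitzMinor (negRecipSeq a) r (fun k => (k : ℕ)) =
      (∏ i : Fin p, (-1 : ℝ) ^ (r i)) * ((∏ k : Fin p, (-1 : ℝ) ^ (k : ℕ)) * M.det) := by
    unfold toeplitzMinor
    rw [← Matrix.det_mul_row, ← Matrix.det_mul_column]
    congr 1
    ext i k
    simp only [Matrix.of_apply, hM]
    rw [seqZ_natCast_sub_natCast, seqZ_natCast_sub_natCast]
    split_ifs with hki
    · rw [negRecipSeq, neg_one_pow_sub' hki]; ring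
    · simp
  rw [htarget, hdetM, Finset.prod_pow_eq_pow_sum, Finset.prod_pow_eq_pow_sum, ← mul_assoc,
    ← mul_assoc, ← pow_add, ← pow_add]
  have heven : Even ((∑ i : Fin p, r i) + (∑ k : Fin p, (k : ℕ)) + ∑ i : Fin p, (r i - i)) := by
    have : (∑ k : Fin p, (k : ℕ)) + ∑ i : Fin p, (r i - i) = ∑ i : Fin p, r i := by
      rw [← Finset.sum_add_distrib]
      exact Finset.sum_congr rfl fun i _ => Nat.add_sub_cancel' (le_of_strictMono_fin hr i)
    rw [add_assoc, this]
    exact ⟨_, rfl⟩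
  rw [heven.neg_one_pow, one_mul]
  exact hA22_nonneg

/-- **Consecutive-column minors of `1/F(-z)` are non-negative.** For a Pólya frequency sequence
`a` with `a₀ = 1` and `b = negRecipSeq a`, every minor of the Toeplitz matrix `(b_{i-j})` with
arbitrary rows and CONSECUTIVE columns `j, j+1, …, j+p-1` is `≥ 0`.
[Aissen–Schoenberg–Whitney 1952, §2] [cite: Karlin1968, Ch. 8 §3] -/
theorem toeplitzMinor_negRecipSeq_consecutive {a : ℕ → ℝ} (hpf : IsPolyaFrequencySeq a)
    (h0 : a 0 = 1) {p : ℕ} (r : Fin p → ℕ) (hr : StrictMono r) (j : ℕ) :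
    0 ≤ toeplitzMinor (negRecipSeq a) r (fun k => j + (k : ℕ)) := by
  rcases Nat.eq_zero_or_pos p with hp | hp
  · subst hp
    simp [toeplitzMinor, Matrix.det_isEmpty]
  by_cases hj : r ⟨0, hp⟩ < j
  · -- the first row vanishes
    unfold toeplitzMinor
    rw [Matrix.det_eq_zero_of_row_eq_zero ⟨0, hp⟩]
    intro k
    simp only [Matrix.of_apply]
    exact seqZ_of_neg _ (by push_cast; omega)
  · push Not at hj
    have hji : ∀ i, j ≤ r i := fun i =>
      hj.trans (hr.monotone (show (⟨0, hp⟩ : Fin p) ≤ i from Fin.mk_le_of_le_val (Nat.zero_le _)))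
    -- shift the rows by `j`
    have hr' : StrictMono fun i => r i - j := fun i i' h => by
      have := hr h
      have := hji i
      simp only
      omega
    have heq : toeplitzMinor (negRecipSeq a) r (fun k => j + (k : ℕ)) =
        toeplitzMinor (negRecipSeq a) (fun i => r i - j) (fun k => (k : ℕ)) := by
      unfold toeplitzMinor
      congr 1
      ext i k
      simp only [Matrix.of_apply]
      congr 1
      have := hji i
      push_cast [this]
      ring
    rw [heq]
    exact toeplitzMinor_negRecipSeq_initial hpf h0 _ hr'

end Literature.Analysis.TotalPositivity

open Filter Topology Finset Matrix

namespace Literature.Analysis.TotalPositivity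

/-! ### Column-positive sequences -/

/-- **Column positivity**: every minor of the Toeplitz matrix `(b_{i-j})` with arbitrary rows and
CONSECUTIVE columns `j, j+1, …` is `≥ 0` (a weakening of PF that is preserved by the deflation
step `b ↦ b - ℓ · Sb`, see `IsColumnPF.mulLinear_neg`). [folklore] -/
def IsColumnPF (b : ℕ → ℝ) : Prop :=
  ∀ (p : ℕ) (r : Fin p → ℕ) (j : ℕ), StrictMono r → 0 ≤ toeplitzMinor b r (fun k => j + (k : ℕ))

/-- PF sequences are column-positive. [folklore] -/
theorem IsPolyaFrequencySeq.isColumnPF {a : ℕ → ℝ} (h : IsPolyaFrequencySeq a) : IsColumnPF a :=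
  fun p r j hr => h p r _ hr fun k l hkl => by simpa using hkl

/-- The terms of a column-positive sequence are `≥ 0` (`1 × 1` minors). [folklore] -/
theorem IsColumnPF.nonneg {b : ℕ → ℝ} (h : IsColumnPF b) (n : ℕ) : 0 ≤ b n := by
  have := h 1 (fun _ => n) 0 (fun i j hij => absurd hij (by simp [Fin.eq_zero i, Fin.eq_zero j]))
  simpa [toeplitzMinor, Matrix.det_unique] using this

/-- The `2 × 2` minors with rows `i < i'` and columns `0, 1`:
`b_{i-1} b_{i'} ≤ b_i b_{i'-1}` (indices via `seqZ`). [folklore] -/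
theorem IsColumnPF.two_by_two {b : ℕ → ℝ} (h : IsColumnPF b) {i i' : ℕ} (hii' : i < i') :
    seqZ b ((i : ℤ) - 1) * b i' ≤ b i * seqZ b ((i' : ℤ) - 1) := by
  have hr : StrictMono ![i, i'] := by
    refine Fin.strictMono_iff_lt_succ.2 fun k => ?_
    fin_cases k; simpa using hii'
  have := h 2 ![i, i'] 0 hr
  rw [toeplitzMinor, Matrix.det_fin_two] at this
  simp only [Matrix.of_apply, Matrix.cons_val_zero, Matrix.cons_val_one] at this
  simp only [Fin.val_zero, Fin.val_one, Nat.cast_zero, Nat.cast_one, zero_add, sub_zero,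
    seqZ_natCast] at this
  linarith

/-- Zeros propagate: if `b_i = 0 < b_{i-1}` hmm — stated as: `b_i > 0` and `b_{i+1} = 0` force
`b_{i'} = 0` for all `i' > i`. [folklore] -/
theorem IsColumnPF.eq_zero_of_succ_eq_zero {b : ℕ → ℝ} (h : IsColumnPF b) {i : ℕ}
    (hi : 0 < b i) (hi1 : b (i + 1) = 0) {i' : ℕ} (hi' : i < i') : b i' = 0 := by
  rcases Nat.lt_or_ge (i + 1) i' with hlt | hge
  · have h2 := h.two_by_two hlt
    have e1 : (((i + 1 : ℕ) : ℤ) - 1) = (i : ℕ) := by push_cast; ring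
    rw [e1, seqZ_natCast, hi1, zero_mul] at h2
    have h3 : 0 ≤ b i' := h.nonneg i'
    nlinarith
  · have : i' = i + 1 := by omega
    rw [this, hi1]

/-- A column-positive sequence with `b₀ > 0` that vanishes somewhere is eventually zero; hence if it
is NOT eventually zero, all its terms are positive. [folklore] -/
theorem IsColumnPF.pos {b : ℕ → ℝ} (h : IsColumnPF b) (h0 : 0 < b 0)
    (hne : ∀ N, ∃ n, N ≤ n ∧ b n ≠ 0) (n : ℕ) : 0 < b n := by
  induction n with
  | zero => exact h0
  | succ n ih =>
    rcases (h.nonneg (n + 1)).lt_or_eq with hpos | hzero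
    · exact hpos
    · exfalso
      obtain ⟨m, hm, hbm⟩ := hne (n + 2)
      exact hbm (h.eq_zero_of_succ_eq_zero ih hzero.symm (by omega))

/-! ### The ratio sequence -/

/-- The ratios `ρₙ = b_{n+1}/bₙ` of a positive column-positive sequence are non-increasing.
[Karlin 1968, Ch. 8, §1 (PF₂ = log-concave)] [folklore] -/
theorem IsColumnPF.ratio_antitone {b : ℕ → ℝ} (h : IsColumnPF b) (hpos : ∀ n, 0 < b n) :
    Antitone fun n => b (n + 1) / b n := by
  refine antitone_nat_of_succ_le fun n => ?_
  have h2 := h.two_by_two (i := n + 1) (i' := n + 2) (by omega)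
  have e1 : (((n + 1 : ℕ) : ℤ) - 1) = (n : ℕ) := by push_cast; ring
  have e2 : (((n + 2 : ℕ) : ℤ) - 1) = ((n + 1 : ℕ) : ℤ) := by push_cast; ring
  rw [e1, e2, seqZ_natCast, seqZ_natCast] at h2
  rw [div_le_div_iff₀ (hpos _) (hpos _)]
  have e3 : n + 1 + 1 = n + 2 := by ring
  rw [e3]
  linarith

/-- The limit ratio `ℓ = inf ρₙ` (`= lim b_{n+1}/bₙ ≥ 0` for positive column-positive `b`,
`IsColumnPF.tendsto_ratio`, `IsColumnPF.ratioLimit_nonneg`; a junk real `⨅` otherwise). [folklore] -/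
def ratioLimit (b : ℕ → ℝ) : ℝ :=
  ⨅ n, b (n + 1) / b n

/-- `ρₙ → ℓ`. [folklore] -/
theorem IsColumnPF.tendsto_ratio {b : ℕ → ℝ} (h : IsColumnPF b) (hpos : ∀ n, 0 < b n) :
    Tendsto (fun n => b (n + 1) / b n) atTop (𝓝 (ratioLimit b)) :=
  tendsto_atTop_ciInf (h.ratio_antitone hpos) ⟨0, by
    rintro _ ⟨n, rfl⟩; exact (div_pos (hpos _) (hpos _)).le⟩

/-- `ℓ ≥ 0`. [folklore] -/
theorem IsColumnPF.ratioLimit_nonneg {b : ℕ → ℝ} (_h : IsColumnPF b) (hpos : ∀ n, 0 < b n) :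
    0 ≤ ratioLimit b :=
  le_ciInf fun _ => (div_pos (hpos _) (hpos _)).le

/-- `ℓ ≤ ρₙ` for every `n`. [folklore] -/
theorem IsColumnPF.ratioLimit_le {b : ℕ → ℝ} (_h : IsColumnPF b) (hpos : ∀ n, 0 < b n) (n : ℕ) :
    ratioLimit b ≤ b (n + 1) / b n :=
  ciInf_le ⟨0, by rintro _ ⟨m, rfl⟩; exact (div_pos (hpos _) (hpos _)).le⟩ n

/-- `b_{n+s}/bₙ → ℓˢ`. [folklore] -/
theorem IsColumnPF.tendsto_ratio_pow {b : ℕ → ℝ} (h : IsColumnPF b) (hpos : ∀ n, 0 < b n)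
    (s : ℕ) : Tendsto (fun n => b (n + s) / b n) atTop (𝓝 (ratioLimit b ^ s)) := by
  induction s with
  | zero => simp [div_self (hpos _).ne']
  | succ s ih =>
    have h1 : Tendsto (fun n => b (n + s + 1) / b (n + s)) atTop (𝓝 (ratioLimit b)) :=
      (h.tendsto_ratio hpos).comp (tendsto_add_atTop_nat s)
    have := h1.mul ih
    rw [pow_succ, mul_comm (ratioLimit b ^ s)]
    refine this.congr fun n => ?_
    rw [← add_assoc]
    field_simp [(hpos (n + s)).ne', (hpos n).ne']

/-- Lower bound `bₙ ≥ ℓⁿ b₀`. [folklore] -/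
theorem IsColumnPF.pow_ratioLimit_le {b : ℕ → ℝ} (h : IsColumnPF b) (hpos : ∀ n, 0 < b n)
    (n : ℕ) : ratioLimit b ^ n * b 0 ≤ b n := by
  induction n with
  | zero => simp
  | succ n ih =>
    have h1 := h.ratioLimit_le hpos n
    rw [le_div_iff₀ (hpos n)] at h1
    calc ratioLimit b ^ (n + 1) * b 0 = ratioLimit b * (ratioLimit b ^ n * b 0) := by ring
      _ ≤ ratioLimit b * b n := mul_le_mul_of_nonneg_left ih (h.ratioLimit_nonneg hpos)
      _ ≤ b (n + 1) := h1

/-- Upper bound: for `ε > 0`, eventually `b_{n} ≤ C (ℓ + ε)ⁿ`. [folklore] -/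
theorem IsColumnPF.exists_le_pow {b : ℕ → ℝ} (h : IsColumnPF b) (hpos : ∀ n, 0 < b n) {ε : ℝ}
    (hε : 0 < ε) : ∃ (C : ℝ) (n₀ : ℕ), 0 < C ∧ ∀ n, n₀ ≤ n → b n ≤ C * (ratioLimit b + ε) ^ n := by
  have hev : ∀ᶠ n in atTop, b (n + 1) / b n < ratioLimit b + ε :=
    (h.tendsto_ratio hpos).eventually (gt_mem_nhds (by linarith))
  obtain ⟨n₀, hn₀⟩ := eventually_atTop.1 hev
  have hq : 0 < ratioLimit b + ε := by linarith [h.ratioLimit_nonneg hpos]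
  refine ⟨b n₀ / (ratioLimit b + ε) ^ n₀, n₀, div_pos (hpos _) (pow_pos hq _), fun n hn => ?_⟩
  obtain ⟨k, rfl⟩ := Nat.exists_eq_add_of_le hn
  induction k with
  | zero => rw [add_zero, div_mul_cancel₀ _ (pow_ne_zero _ hq.ne')]
  | succ k ih =>
    have h1 := hn₀ (n₀ + k) (by omega)
    rw [div_lt_iff₀ (hpos _)] at h1
    calc b (n₀ + (k + 1)) = b (n₀ + k + 1) := by rw [add_assoc]
      _ ≤ (ratioLimit b + ε) * b (n₀ + k) := h1.le
      _ ≤ (ratioLimit b + ε) * (b n₀ / (ratioLimit b + ε) ^ n₀ * (ratioLimit b + ε) ^ (n₀ + k)) :=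
          mul_le_mul_of_nonneg_left (ih (by omega)) hq.le
      _ = b n₀ / (ratioLimit b + ε) ^ n₀ * (ratioLimit b + ε) ^ (n₀ + (k + 1)) := by ring

/-! ### The virtual row: deflation `b ↦ b - ℓ · Sb` preserves column positivity -/

/-- The strict lower shift matrix `L_{s,k} = [s = k + 1]`. [folklore] -/
def lowerShift (m : ℕ) : Matrix (Fin m) (Fin m) ℝ :=
  Matrix.of fun s k => if (s : ℕ) = (k : ℕ) + 1 then 1 else 0

/-- Right multiplication by the lower shift moves column `k+1` to column `k`. [folklore] -/
theorem mul_lowerShift_apply {m : ℕ} (M : Matrix (Fin m) (Fin m) ℝ) (i k : Fin m) :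
    (M * lowerShift m) i k = if h : (k : ℕ) + 1 < m then M i ⟨(k : ℕ) + 1, h⟩ else 0 := by
  rw [Matrix.mul_apply]
  split_ifs with h
  · rw [Finset.sum_eq_single ⟨(k : ℕ) + 1, h⟩]
    · simp [lowerShift]
    · intro s _ hs
      have : (s : ℕ) ≠ (k : ℕ) + 1 := fun h' => hs (Fin.ext h')
      simp [lowerShift, this]
    · intro h'; exact absurd (Finset.mem_univ _) h'
  · refine Finset.sum_eq_zero fun s _ => ?_
    have : (s : ℕ) ≠ (k : ℕ) + 1 := fun h' => h (by have := s.2; omega)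
    simp [lowerShift, this]

/-- `det (1 + c • L) = 1` (unit lower triangular). [folklore] -/
theorem det_one_add_smul_lowerShift (m : ℕ) (c : ℝ) :
    (1 + c • lowerShift m).det = 1 := by
  rw [Matrix.det_of_lowerTriangular]
  · refine Finset.prod_eq_one fun i _ => ?_
    simp [lowerShift]
  · intro i k hik
    have hlt : (i : ℕ) < k := hik
    have h1 : (i : ℕ) ≠ (k : ℕ) + 1 := by omega
    have h2 : i ≠ k := fun h => by rw [h] at hlt; exact lt_irrefl _ hlt
    simp [lowerShift, h1, h2]

/-- **The virtual row.** Let `b` be column-positive with all `bₙ > 0` and `b_{n+s}/bₙ → ℓˢ` for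
every `s`. Then `b̃ₙ := bₙ - ℓ b_{n-1}` (the coefficients of `(1 - ℓz) Σ bₙ zⁿ`) is again
column-positive. Proof: a minor of `b̃` with rows `I` and columns `j, …, j+p-1` is the limit, as
`N → ∞`, of the minors of `b` with rows `I ∪ {N}` and columns `j, …, j+p` divided by
`b_{N-j-p} > 0`: right-multiply the latter matrix by the unit bidiagonal `1 - ℓ L` and normalise
its last row, which tends to `(0, …, 0, 1)`. (cf. Aissen–Schoenberg–Whitney 1952, §3).
[cite: AissenSchoenbergWhitney1952, §3] -/
theorem IsColumnPF.mulLinear_neg {b : ℕ → ℝ} (hb : IsColumnPF b) (hpos : ∀ n, 0 < b n) {ℓ : ℝ}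
    (hlim : ∀ s : ℕ, Tendsto (fun n => b (n + s) / b n) atTop (𝓝 (ℓ ^ s))) :
    IsColumnPF (mulLinear b (-ℓ)) := by
  classical
  intro p r j hr
  -- extended rows `r, N`
  let rN : ℕ → Fin (p + 1) → ℕ := fun N i => if h : (i : ℕ) < p then r ⟨i, h⟩ else N
  have hrN_lo : ∀ N (i : Fin (p + 1)) (h : (i : ℕ) < p), rN N i = r ⟨i, h⟩ := fun N i h => by
    simp [rN, h]
  have hrN_hi : ∀ N (i : Fin (p + 1)), ¬ (i : ℕ) < p → rN N i = N := fun N i h => by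
    simp [rN, h]
  have hrlt : ∀ (i : Fin p), r i < (Finset.univ.sup r) + 1 := fun i =>
    Nat.lt_succ_of_le (Finset.le_sup (Finset.mem_univ i))
  have hrN_mono : ∀ N, Finset.univ.sup r + 1 ≤ N → StrictMono (rN N) := by
    intro N hN i i' hii'
    have hlt : (i : ℕ) < i' := hii'
    by_cases hi' : (i' : ℕ) < p
    · have hi : (i : ℕ) < p := lt_trans hlt hi'
      rw [hrN_lo N i hi, hrN_lo N i' hi']
      exact hr (show (⟨i, hi⟩ : Fin p) < ⟨i', hi'⟩ from hlt)
    · rw [hrN_hi N i' hi']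
      have hi : (i : ℕ) < p := by have := i'.2; omega
      rw [hrN_lo N i hi]
      exact lt_of_lt_of_le (hrlt _) hN
  -- the big minors of `b`
  let M : ℕ → Matrix (Fin (p + 1)) (Fin (p + 1)) ℝ := fun N =>
    Matrix.of fun i k => seqZ b ((rN N i : ℤ) - ((j + (k : ℕ) : ℕ) : ℤ))
  have hM_nonneg : ∀ N, Finset.univ.sup r + 1 ≤ N → 0 ≤ (M N).det := fun N hN =>
    hb (p + 1) (rN N) j (hrN_mono N hN)
  -- the top rows after the column operation
  let T : Fin p → Fin (p + 1) → ℝ := fun i k =>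
    seqZ b ((r i : ℤ) - ((j + (k : ℕ) : ℕ) : ℤ)) -
      ℓ * (if (k : ℕ) + 1 < p + 1 then seqZ b ((r i : ℤ) - ((j + ((k : ℕ) + 1) : ℕ) : ℤ)) else 0)
  -- the last row after the column operation, as a function of `n = N - j - p`
  let g : Fin (p + 1) → ℕ → ℝ := fun k n =>
    b (n + (p - k)) / b n - ℓ * (if (k : ℕ) + 1 < p + 1 then b (n + (p - (k + 1))) / b n else 0)
  have hg : ∀ k : Fin (p + 1), Tendsto (g k) atTop (𝓝 (if (k : ℕ) = p then 1 else 0)) := by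
    intro k
    have h1 := (hlim (p - k)).sub ((hlim (p - (k + 1))).const_mul ℓ |>.mul_const
      (if (k : ℕ) + 1 < p + 1 then (1 : ℝ) else 0))
    have hk := k.2
    refine (h1.congr fun n => ?_).trans ?_
    · simp only [g]
      split_ifs <;> ring
    · by_cases hkp : (k : ℕ) = p
      · rw [if_pos hkp, if_neg (by omega), hkp]; simp
      · rw [if_neg hkp, if_pos (by omega)]
        have : p - k = (p - (k + 1)) + 1 := by omega
        rw [this, pow_succ]
        simp [mul_comm]
  -- the normalised matrices and their limit
  let V : ℕ → Matrix (Fin (p + 1)) (Fin (p + 1)) ℝ := fun N =>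
    Matrix.of fun i k => if h : (i : ℕ) < p then T ⟨i, h⟩ k else g k (N - (j + p))
  let E : Matrix (Fin (p + 1)) (Fin (p + 1)) ℝ :=
    Matrix.of fun i k => if h : (i : ℕ) < p then T ⟨i, h⟩ k else (if (k : ℕ) = p then 1 else 0)
  have hVE : Tendsto V atTop (𝓝 E) := by
    refine tendsto_pi_nhds.2 fun i => tendsto_pi_nhds.2 fun k => ?_
    by_cases hi : (i : ℕ) < p
    · simp only [V, E, Matrix.of_apply, dif_pos hi]; exact tendsto_const_nhds
    · simp only [V, E, Matrix.of_apply, dif_neg hi]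
      exact (hg k).comp (tendsto_sub_atTop_nat (j + p))
  -- `det (V N) = det (M N) / b (N - j - p)` for `N ≥ j + p`
  have hdetV : ∀ N, j + p ≤ N → (V N).det = (M N).det / b (N - (j + p)) := by
    intro N hN
    -- column operation
    have hW : (M N * (1 + (-ℓ) • lowerShift (p + 1))).det = (M N).det := by
      rw [Matrix.det_mul, det_one_add_smul_lowerShift, mul_one]
    have hWV : V N = Matrix.of fun (i k : Fin (p + 1)) => (if (i : ℕ) < p then (1 : ℝ) else 1 / b (N - (j + p))) *
        (M N * (1 + (-ℓ) • lowerShift (p + 1))) i k := by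
      ext i k
      rw [Matrix.mul_add, Matrix.mul_one, Matrix.mul_smul]
      simp only [Matrix.of_apply, Matrix.add_apply, Matrix.smul_apply, mul_lowerShift_apply,
        smul_eq_mul, V, M]
      by_cases hi : (i : ℕ) < p
      · rw [dif_pos hi, if_pos hi, one_mul, hrN_lo N i hi]
        simp only [T]
        split_ifs with hk <;> ring
      · rw [dif_neg hi, if_neg hi, hrN_hi N i hi]
        simp only [g]
        have hk := k.2
        have e1 : ((N : ℕ) : ℤ) - ((j + (k : ℕ) : ℕ) : ℤ) = ((N - (j + p) + (p - k) : ℕ) : ℤ) := by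
          push_cast; omega
        rw [e1, seqZ_natCast]
        split_ifs with hk1
        · have e2 : ((N : ℕ) : ℤ) - ((j + ((k : ℕ) + 1) : ℕ) : ℤ) =
              ((N - (j + p) + (p - (k + 1)) : ℕ) : ℤ) := by
            push_cast; omega
          rw [e2, seqZ_natCast]
          field_simp
          ring
        · rw [mul_zero, mul_zero, add_zero, sub_zero, one_div, inv_mul_eq_div]
    rw [hWV, Matrix.det_mul_column, hW, Fin.prod_univ_castSucc]
    simp [div_eq_inv_mul]
  -- `det E = target minor`
  have hdetE : E.det = toeplitzMinor (mulLinear b (-ℓ)) r (fun k => j + (k : ℕ)) := by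
    rw [Matrix.det_succ_row E (Fin.last p), Finset.sum_eq_single (Fin.last p)]
    · have hE : E (Fin.last p) (Fin.last p) = 1 := by simp [E]
      rw [hE, mul_one, Fin.succAbove_last, Fin.val_last, ← two_mul, pow_mul]
      norm_num
      unfold toeplitzMinor
      congr 1
      ext i k
      simp only [Matrix.submatrix_apply, E, Matrix.of_apply, Fin.val_castSucc, dif_pos i.2, T,
        Fin.eta, seqZ_mulLinear]
      rw [if_pos (by have := k.2; omega)]
      have e : ((r i : ℤ) - ((j + (k : ℕ) : ℕ) : ℤ)) - 1 = (r i : ℤ) - ((j + ((k : ℕ) + 1) : ℕ) : ℤ) := by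
        push_cast; ring
      rw [e]; ring
    · intro k _ hk
      have : (k : ℕ) ≠ p := fun h => hk (Fin.ext (by simp [h]))
      simp [E, this]
    · intro h; exact absurd (Finset.mem_univ _) h
  -- pass to the limit
  have hlimdet : Tendsto (fun N => (V N).det) atTop (𝓝 E.det) :=
    ((continuous_id.matrix_det).tendsto E).comp hVE
  rw [← hdetE]
  refine ge_of_tendsto hlimdet ?_
  filter_upwards [eventually_ge_atTop (Finset.univ.sup r + 1 + (j + p))] with N hN
  rw [hdetV N (by omega)]
  exact div_nonneg (hM_nonneg N (by omega)) (hpos _).le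

end Literature.Analysis.TotalPositivity
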